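import Summits.CriticalPhenomena.PercolationContinuityZ3.Theorems.PercNearOneGluingNoHeavyQuantFarSunLawAlgebra
import HarnessLib

/-!
# FAR beyond trees: the SUN-LAW DICTIONARY IV — normalisations of the law-level functional (pure algebra, every `g`, `h`)

builds on p205010 (kernel theorem, internal audit signed; external expert review pending)

Support file (`--supports stmt-CriticalPhenomena-4575`), seat `prim-cert-1` (gen 20); QUANT lane rung R8, front "FAR beyond trees" (lead g22).
The bookkeeping identities a law-level proof over `sunLaw` (e.g. prim-quant-p1's STEP 1 "pairs form", `FOR-LEAD-TWOCHAIN-A.md` §4(d) /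
`…-B.md` §6 (ii)) needs, valid for ALL real `g`, `h` (no `[0,1]` hypothesis, no measure theory):

* `hairW_eq_prod_mul_prod`, `sum_hairW_eq_one` — `hairW K h Q = ∏_{Q} h · ∏_{range K ∖ Q} (1 − h)` and **`Σ_{Q ⊆ range K} hairW K h Q = 1`**
  (`Finset.prod_add` on `∏ (h + (1 − h)) = 1`);
* `sum_gaps_eq` — `Σ_{l < l' ≤ K} (α_l − α_{l+1})(β_{l'+1} − β_{l'}) = Σ_{l ≤ K} (α_l − α_{l+1})(1 − β_{l+1})` (inner telescope, `β_{K+1} = 1`);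
* **`gap_masses_total`** — `α_{K+1} + Σ_{l ≤ K} (α_l − α_{l+1}) β_{l+1} + Σ_{l < l' ≤ K} (α_l − α_{l+1})(β_{l'+1} − β_{l'}) = 1` (outer telescope,
  `α_0 = 1`): the "everything covered" mass of `sunLaw_eq_gap_form` is `1 −` the nonempty-gap mass;
* `sunLaw_const` — hence `sunLaw K g h Φ = (if Φ-value is constant c then c)`: `sunLaw K g h (fun _ => True) = 1` and `(fun _ => False) = 0` for
  ALL `g, h` (`sunLaw_true'`, `sunLaw_false`), upgrading `sunLaw_true` of `…QuantFarSunLawAlgebra` (which assumed `g, h ∈ [0,1]`).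
No sorries; standard axioms.  Elementary [this work].
-/

noncomputable section

namespace Summit.CriticalPhenomena.PercolationContinuityZ3.Theorems.HairyCycle

open Finset
open scoped Classical

variable {K : ℕ}

/-! ## The hair weights sum to one -/

/-- `hairW K h Q = (∏_{k ∈ Q} h k) · ∏_{k ∈ range K ∖ Q} (1 − h k)` for `Q ⊆ range K`. [this work] -/
theorem hairW_eq_prod_mul_prod (h : ℕ → ℝ) {Q : Finset ℕ} (hQ : Q ⊆ range K) :
    hairW K h Q = (∏ k ∈ Q, h k) * ∏ k ∈ range K \ Q, (1 - h k) := by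
  unfold hairW
  rw [Finset.prod_ite]
  congr 1
  · rw [Finset.filter_mem_eq_inter, Finset.inter_eq_right.2 hQ]
  · congr 1
    ext k
    rw [Finset.mem_filter, Finset.mem_sdiff]

/-- **`Σ_{Q ⊆ range K} hairW K h Q = 1`** (every real `h`). [this work] -/
theorem sum_hairW_eq_one (h : ℕ → ℝ) : ∑ Q ∈ (range K).powerset, hairW K h Q = 1 := by
  have key := Finset.prod_add (fun k => h k) (fun k => 1 - h k) (range K)
  have h1 : ∏ k ∈ range K, (h k + (1 - h k)) = 1 := Finset.prod_eq_one fun k _ => by ring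
  rw [h1] at key
  rw [key]
  refine Finset.sum_congr rfl fun Q hQ => ?_
  rw [Finset.mem_powerset] at hQ
  rw [hairW_eq_prod_mul_prod h hQ]

/-! ## The arc weights sum to one -/

/-- `α_0 = 1`. [this work] -/
theorem arcA_zero (g : ℕ → ℝ) : arcA g 0 = 1 := by
  unfold arcA; rw [Finset.range_zero, Finset.prod_empty]

/-- The nonempty-gap mass, inner telescope: `Σ_{l < l' ≤ K} (α_l − α_{l+1})(β_{l'+1} − β_{l'}) = Σ_{l ≤ K} (α_l − α_{l+1})(1 − β_{l+1})`. [this work] -/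
theorem sum_gaps_eq (g : ℕ → ℝ) :
    ∑ p ∈ (arcIx K).filter (fun p => p.1 < p.2 ∧ p.2 ≤ K),
        (arcA g p.1 - arcA g (p.1 + 1)) * (arcB K g (p.2 + 1) - arcB K g p.2) =
      ∑ l ∈ range (K + 1), (arcA g l - arcA g (l + 1)) * (1 - arcB K g (l + 1)) := by
  have hset : (arcIx K).filter (fun p => p.1 < p.2 ∧ p.2 ≤ K) =
      (range (K + 1) ×ˢ range (K + 1)).filter (fun p : ℕ × ℕ => p.1 < p.2) := by
    ext p
    rw [Finset.mem_filter, mem_arcIx, Finset.mem_filter, Finset.mem_product, Finset.mem_range, Finset.mem_range]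
    omega
  rw [hset, Finset.sum_filter, Finset.sum_product]
  refine Finset.sum_congr rfl fun l hl => ?_
  rw [Finset.mem_range] at hl
  rw [← Finset.sum_filter]
  have hI : (range (K + 1)).filter (fun l' => l < l') = Ico (l + 1) (K + 1) := by
    ext l'
    rw [Finset.mem_filter, Finset.mem_range, Finset.mem_Ico]
    omega
  have hfilt : (range (K + 1)).filter (fun l' => ((l, l') : ℕ × ℕ).1 < ((l, l') : ℕ × ℕ).2) =
      (range (K + 1)).filter (fun l' => l < l') := rfl
  rw [hfilt, hI]
  dsimp only
  rw [← Finset.mul_sum, Finset.sum_Ico_sub (f := fun i => arcB K g i) (by omega), arcB_top]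

/-- **The closed-extent masses sum to one**: `α_{K+1} + Σ_{l ≤ K} (α_l − α_{l+1}) β_{l+1} + Σ_{l < l' ≤ K} (α_l − α_{l+1})(β_{l'+1} − β_{l'}) = 1`
(every real `g`): in `sunLaw_eq_gap_form` the "everything covered" mass is one minus the nonempty-gap mass. [this work] -/
theorem gap_masses_total (g : ℕ → ℝ) :
    (arcA g (K + 1) + ∑ l ∈ range (K + 1), (arcA g l - arcA g (l + 1)) * arcB K g (l + 1)) +
      ∑ p ∈ (arcIx K).filter (fun p => p.1 < p.2 ∧ p.2 ≤ K),
        (arcA g p.1 - arcA g (p.1 + 1)) * (arcB K g (p.2 + 1) - arcB K g p.2) = 1 := by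
  rw [sum_gaps_eq, add_assoc, ← Finset.sum_add_distrib]
  have h1 : ∑ l ∈ range (K + 1), ((arcA g l - arcA g (l + 1)) * arcB K g (l + 1) +
      (arcA g l - arcA g (l + 1)) * (1 - arcB K g (l + 1))) = ∑ l ∈ range (K + 1), (arcA g l - arcA g (l + 1)) :=
    Finset.sum_congr rfl fun l _ => by ring
  rw [h1, Finset.sum_range_sub' (fun i => arcA g i), arcA_zero]
  ring

/-! ## Consequences for `sunLaw` -/

/-- `sunLaw` of a constant predicate, every real `g`, `h`: `sunLaw K g h (fun _ => P) = if P then 1 else 0`. [this work] -/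
theorem sunLaw_const (g h : ℕ → ℝ) (P : Prop) : sunLaw K g h (fun _ => P) = if P then 1 else 0 := by
  rw [sunLaw_eq_gap_form]
  have hQ : ∀ Q ∈ (range K).powerset, hairW K h Q *
      ((arcA g (K + 1) + ∑ l ∈ range (K + 1), (arcA g l - arcA g (l + 1)) * arcB K g (l + 1)) * (if P then 1 else 0) +
        ∑ p ∈ (arcIx K).filter (fun p => p.1 < p.2 ∧ p.2 ≤ K),
          (arcA g p.1 - arcA g (p.1 + 1)) * (arcB K g (p.2 + 1) - arcB K g p.2) * (if P then 1 else 0)) =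
      hairW K h Q * (if P then 1 else 0) := by
    intro Q _
    rw [← Finset.sum_mul, ← add_mul, gap_masses_total, one_mul]
  rw [Finset.sum_congr rfl hQ, ← Finset.sum_mul, sum_hairW_eq_one, one_mul]

/-- `sunLaw K g h (fun _ => True) = 1` for ALL real `g`, `h`. [this work] -/
theorem sunLaw_true' (g h : ℕ → ℝ) : sunLaw K g h (fun _ => True) = 1 := by
  rw [sunLaw_const, if_pos trivial]

/-- `sunLaw K g h (fun _ => False) = 0` for ALL real `g`, `h`. [this work] -/
theorem sunLaw_false (g h : ℕ → ℝ) : sunLaw K g h (fun _ => False) = 0 := by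
  rw [sunLaw_const, if_neg not_false]

end Summit.CriticalPhenomena.PercolationContinuityZ3.Theorems.HairyCycle

end
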